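import Literature.NumberTheory.CubicFields.CubicFieldDiscriminant307ClassNumber
import HarnessLib

/-!
# The cubic field of discriminant `−1763`: `F = ℚ(θ)`, `f(θ) = 0`, `f = X³ − X² − 13X − 16` — `𝓞_F = ℤ[θ]`, `d_F = −1763`,
# signature `(1, 1)`, the primes of norm `≤ 11`, and CLASS NUMBER ONE (LMFDB number field 3.1.1763.1) — PROVED

Topic `Literature/NumberTheory/CubicFields`, namespace `Literature.NumberTheory.CubicFields.CubicDisc1763` (the object: the cubic field of
discriminant `−1763`; same template as `CubicFieldDiscriminant307ClassNumber.lean` / `…139…` of the same seat).  THEOREMS ONLY (no definition,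
no named fact, no instance, no notation); every statement is PROVED.  Written by the prover seat `bsd-line-att-p4` g27 (cell `bsd-f1-sign2`) so that
the `2 ∤ h(ℚ(β))` datum of the cubic Chevalley road of crux C2 (route `AlignedTransportAtTwo`) is a kernel theorem for the odd-branch seed of
conductor `1763` (att-p5 g31's census: the unit-sign door fires there; `ℚ(β)` has discriminant `−1763`, squarefree, so it is THIS field — the number of
cubic fields of a fundamental discriminant `D < 0` is `(#Cl(ℚ(√D))[3] − 1)/2`, here `1`; a model inside `ℚ(β)` is exhibited downstream, not here: for the curve `[1,0,1,−3,−3]` (N = 1763 = 41·43), `u = 4β` a root of `u³ + u² − 40u − 176`, the element `θ = (u² + 5u − 20)/16` is a root of `f` (h(ℚ(√−1763)) = 12, 3-rank 1)).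

## Source

[LMFDB] The L-functions and Modular Forms Database, number field `3.1.1763.1`: degree `3`, signature `[1, 1]`, discriminant `−1763`, **class number `1`**
(table entries). D. A. Marcus, *Number Fields*, 2nd ed. (2018) [Marcus2018], Ch. 2 Ex. 27 (index criterion), Ch. 3 Thm. 27 (Dedekind–Kummer),
Ch. 5 Thm. 37 and Cor. 2 (the class group is generated by the primes of norm at most the Minkowski bound).

## Carrier

`F` is ANY number field with `[F : ℚ] = 3` containing `α` with `aeval α f = 0` for the tree's `f = MonicCubic.poly (-1) (-13) (-16) ∈ ℤ[X]`
(every model of the cubic field of discriminant `−1763`).  `θ := MonicCubic.thetaInt hα ∈ 𝓞 F`.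

## What is formalised (all PROVED)

* §1 the polynomial: `disc_eq` (`Δ(f) = −1763`, squarefree), `isUnit_of_disc_eq_sq_mul`, `no_root_3` / `irreducible_polyQ` (no root mod `3`),
  `polyMod_eq` and the factorisations `polyMod_<p>` of `f mod p` for the split primes `p ≤ 11`.
* §2 the field: `discr_eq` (**`d_F = −1763`**), `adjoin_thetaInt_eq_top` (**`𝓞_F = ℤ[θ]`**), `nrComplexPlaces_eq_one` (**signature `(1, 1)`**).
* §3 every prime of `𝓞_F` above a prime `p ≤ 11` with `p^f ≤ 11` is principal, by EXPLICIT GENERATORS (pure ideal arithmetic from `f(θ) = 0`)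
  or because `p` is inert (`isPrincipal_of_mem_primesOver_<p>`).
* §4 ★ **`h_F = 1`** (`isPrincipalIdealRing`, `classNumber_eq_one`; Minkowski `(4/π)(3!/3³)√1763 ≈ 11.88 < 12`, Mathlib's
  `RingOfIntegers.isPrincipalIdealRing_of_isPrincipal_of_pow_le_of_mem_primesOver_of_mem_Icc`) and `not_two_dvd_classNumber`.

## References
* [LMFDB] The LMFDB Collaboration, The L-functions and Modular Forms Database, number field 3.1.1763.1.
* [Marcus2018] D. A. Marcus, *Number Fields*, 2nd ed., Universitext, Springer 2018, Ch. 2 Ex. 27, Ch. 3 Thm. 27, Ch. 5 Thm. 37.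
-/

noncomputable section

open Polynomial NumberField NumberField.InfinitePlace Ideal Module Real
open Literature.NumberTheory.NumberFields
open Literature.NumberTheory.NumberFields.MonicCubic

namespace Literature.NumberTheory.CubicFields.CubicDisc1763

/-! ## §1 The polynomial `f = MonicCubic.poly (-1) (-13) (-16)` -/

/-- `Δ(f) = −1763`. [cite: LMFDB, number field 3.1.1763.1 (discriminant −1763)] -/
theorem disc_eq : disc (-1) (-13) (-16) = -1763 := by
  norm_num [disc]

/-- The square-factor condition of the tree's index criterion for `f`: `−1763 = r²e` with `|e| > 2` forces `r = ±1`
(`1763` is squarefree). [cite: Marcus2018, Ch. 2, Exercise 27] -/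
theorem isUnit_of_disc_eq_sq_mul : ∀ r e : ℤ, disc (-1) (-13) (-16) = r ^ 2 * e → 2 < |e| → IsUnit r := by
  intro r e h _
  rw [disc_eq] at h
  have hdvd : r.natAbs ^ 2 ∣ 1763 := by
    have h1 : r ^ 2 ∣ (1763 : ℤ) := ⟨-e, by linear_combination -h⟩
    have h2 : ((r.natAbs ^ 2 : ℕ) : ℤ) ∣ (1763 : ℕ) := by
      rw [Nat.cast_pow, Int.natCast_natAbs, sq_abs]; exact_mod_cast h1
    exact Int.natCast_dvd_natCast.mp h2
  have hle : r.natAbs ≤ 42 := by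
    have := Nat.le_of_dvd (by norm_num) hdvd
    nlinarith
  rw [Int.isUnit_iff_natAbs_eq]
  interval_cases hr : r.natAbs <;> omega

/-- `f` has no root modulo `3`. [cite: Marcus2018, Ch. 3, Thm. 27] -/
theorem no_root_3 :
    ∀ r : ZMod 3, r ^ 3 + ((-1 : ℤ) : ZMod 3) * r ^ 2 + ((-13 : ℤ) : ZMod 3) * r + ((-16 : ℤ) : ZMod 3) ≠ 0 := by
  decide

/-- **`f` is irreducible over `ℚ`** (no root modulo `3`; the tree's `irreducible_polyQ_of_no_root`). [cite: LMFDB, number field 3.1.1763.1 (degree 3)] -/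
theorem irreducible_polyQ : Irreducible (polyQ (-1) (-13) (-16)) :=
  haveI : Fact (Nat.Prime 3) := ⟨by norm_num⟩
  irreducible_polyQ_of_no_root 3 no_root_3

/-- `f mod p` written out. [cite: Marcus2018, Ch. 3, Thm. 27] -/
theorem polyMod_eq (p : ℕ) : polyMod (-1) (-13) (-16) p = ((-16) + (-13) * X + (-1) * X ^ 2 + X ^ 3 : (ZMod p)[X]) := by
  simp [polyMod, poly]; ring

/-- The factorisation of `f` modulo `2`. [cite: Marcus2018, Ch. 3, Thm. 27] -/
theorem polyMod_2 : polyMod (-1) (-13) (-16) 2 = X * (X ^ 2 + X + 1) := by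
  rw [polyMod_eq]
  have hp : (2 : (ZMod 2)[X]) = 0 := by
    rw [show (2 : (ZMod 2)[X]) = C 2 from (map_natCast C 2).symm, show (2 : ZMod 2) = 0 from rfl, C_0]
  linear_combination ((-8) + (-7) * X + (-1) * X ^ 2 : (ZMod 2)[X]) * hp

/-- The factorisation of `f` modulo `5`. [cite: Marcus2018, Ch. 3, Thm. 27] -/
theorem polyMod_5 : polyMod (-1) (-13) (-16) 5 = (X + 1) * (X ^ 2 + 3 * X + 4) := by
  rw [polyMod_eq]
  have hp : (5 : (ZMod 5)[X]) = 0 := by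
    rw [show (5 : (ZMod 5)[X]) = C 5 from (map_natCast C 5).symm, show (5 : ZMod 5) = 0 from rfl, C_0]
  linear_combination ((-4) + (-4) * X + (-1) * X ^ 2 : (ZMod 5)[X]) * hp

/-- The quadratic factor of `f mod 5` is irreducible (no root). [cite: Marcus2018, Ch. 3, Thm. 27] -/
theorem irreducible_quad_5 : Irreducible (X ^ 2 + 3 * X + 4 : (ZMod 5)[X]) := by
  have hnr : ∀ x : ZMod 5, x ^ 2 + 3 * x + 4 ≠ 0 := by decide
  haveI : Fact (Nat.Prime 5) := ⟨by norm_num⟩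
  have hdeg : (X ^ 2 + 3 * X + 4 : (ZMod 5)[X]).natDegree = 2 := by compute_degree!
  refine irreducible_of_degree_le_three_of_not_isRoot (by rw [hdeg]; decide) fun x hx => hnr x ?_
  simpa only [IsRoot.def, eval_add, eval_mul, eval_pow, eval_X, eval_ofNat] using hx

/-- The factorisation of `f` modulo `11`. [cite: Marcus2018, Ch. 3, Thm. 27] -/
theorem polyMod_11 : polyMod (-1) (-13) (-16) 11 = (X + 4) * (X ^ 2 + 6 * X + 7) := by
  rw [polyMod_eq]
  have hp : (11 : (ZMod 11)[X]) = 0 := by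
    rw [show (11 : (ZMod 11)[X]) = C 11 from (map_natCast C 11).symm, show (11 : ZMod 11) = 0 from rfl, C_0]
  linear_combination ((-4) + (-4) * X + (-1) * X ^ 2 : (ZMod 11)[X]) * hp

/-- The quadratic factor of `f mod 11` is irreducible (no root). [cite: Marcus2018, Ch. 3, Thm. 27] -/
theorem irreducible_quad_11 : Irreducible (X ^ 2 + 6 * X + 7 : (ZMod 11)[X]) := by
  have hnr : ∀ x : ZMod 11, x ^ 2 + 6 * x + 7 ≠ 0 := by decide
  haveI : Fact (Nat.Prime 11) := ⟨by norm_num⟩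
  have hdeg : (X ^ 2 + 6 * X + 7 : (ZMod 11)[X]).natDegree = 2 := by compute_degree!
  refine irreducible_of_degree_le_three_of_not_isRoot (by rw [hdeg]; decide) fun x hx => hnr x ?_
  simpa only [IsRoot.def, eval_add, eval_mul, eval_pow, eval_X, eval_ofNat] using hx

/-! ## §2 The field `F`: `d_F = −1763`, `𝓞_F = ℤ[θ]`, signature `(1, 1)` -/

section NumberField

variable {F : Type*} [Field F] [NumberField F] {α : F}

/-- **`d_F = −1763`** (index criterion: `Δ(f)` squarefree, so `1, α, α²` is an integral basis). [cite: LMFDB, number field 3.1.1763.1 (discriminant −1763)]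
[cite: Marcus2018, Ch. 2, Exercise 27] -/
theorem discr_eq (h3 : finrank ℚ F = 3) (hα : aeval α (poly (-1) (-13) (-16)) = 0) : discr F = -1763 := by
  rw [discr_eq_disc irreducible_polyQ hα h3 isUnit_of_disc_eq_sq_mul, disc_eq]

/-- **`𝓞_F = ℤ[θ]`** (inside `𝓞_F`). [cite: Marcus2018, Ch. 2, Exercise 27] -/
theorem adjoin_thetaInt_eq_top (h3 : finrank ℚ F = 3) (hα : aeval α (poly (-1) (-13) (-16)) = 0) :
    Algebra.adjoin ℤ ({thetaInt hα} : Set (𝓞 F)) = ⊤ :=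
  MonicCubic.adjoin_thetaInt_eq_top irreducible_polyQ hα h3 isUnit_of_disc_eq_sq_mul

/-- **`F` has exactly one complex place** (`r₂ = 1`): `d_F < 0` has sign `(−1)^{r₂}`, and `r₁ + 2r₂ = 3`. [cite: LMFDB, number field 3.1.1763.1 (signature [1,1])] -/
theorem nrComplexPlaces_eq_one (h3 : finrank ℚ F = 3) (hα : aeval α (poly (-1) (-13) (-16)) = 0) : nrComplexPlaces F = 1 := by
  have hsum := card_add_two_mul_card_eq_rank F
  rw [h3] at hsum
  have hsign := NumberField.sign_discr F
  rw [discr_eq h3 hα] at hsign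
  have hle : nrComplexPlaces F ≤ 1 := by omega
  rcases Nat.le_one_iff_eq_zero_or_eq_one.mp hle with h0 | h1
  · rw [h0, pow_zero, show (-1763 : ℤ).sign = -1 from rfl] at hsign
    norm_num at hsign
  · exact h1

/-- The cubic relation `θ³ + aθ² + bθ + c = 0` in `𝓞_F`, numerals pushed (private helper). [folklore] -/
private theorem theta_rel (hα : aeval α (poly (-1) (-13) (-16)) = 0) :
    thetaInt hα ^ 3 + (-1) * thetaInt hα ^ 2 + (-13) * thetaInt hα + (-16) = 0 := by
  have h := thetaInt_rel hα
  push_cast at h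
  linear_combination h

/-! ## §3 The primes of norm `≤ 11` are principal -/

/-- `(2, θ + 0) = (-2 - θ)` (an element of norm `±2`). [cite: Marcus2018, Ch. 3, Thm. 27] -/
theorem span_2_lin0_eq (hα : aeval α (poly (-1) (-13) (-16)) = 0) :
    span {(2 : 𝓞 F), thetaInt hα} = span {-2 - thetaInt hα} := by
  have hrel := theta_rel hα
  apply le_antisymm
  · rw [span_le]
    rintro x hx
    rcases hx with rfl | hx
    · exact mem_span_singleton'.mpr ⟨7 + 3 * thetaInt hα - thetaInt hα ^ 2, by linear_combination (1) * hrel⟩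
    · rw [Set.mem_singleton_iff.mp hx]
      exact mem_span_singleton'.mpr ⟨-8 - 3 * thetaInt hα + thetaInt hα ^ 2, by linear_combination (-1) * hrel⟩
  · rw [span_singleton_le_iff_mem, mem_span_pair]
    exact ⟨39 + 35 * thetaInt hα + 5 * thetaInt hα ^ 2, -6 - 5 * thetaInt hα - 5 * thetaInt hα ^ 2, by linear_combination (-5) * hrel⟩

/-- `(2, θ² + 1θ + 1) = (-7 - 3 * θ + θ ^ 2)` (an element of norm `4`). [cite: Marcus2018, Ch. 3, Thm. 27] -/
theorem span_2_quad_eq (hα : aeval α (poly (-1) (-13) (-16)) = 0) :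
    span {(2 : 𝓞 F), thetaInt hα ^ 2 + thetaInt hα + 1} = span {-7 - 3 * thetaInt hα + thetaInt hα ^ 2} := by
  have hrel := theta_rel hα
  apply le_antisymm
  · rw [span_le]
    rintro x hx
    rcases hx with rfl | hx
    · exact mem_span_singleton'.mpr ⟨2 + thetaInt hα, by linear_combination (1) * hrel⟩
    · rw [Set.mem_singleton_iff.mp hx]
      exact mem_span_singleton'.mpr ⟨9 + 8 * thetaInt hα + 2 * thetaInt hα ^ 2, by linear_combination (4 + 2 * thetaInt hα) * hrel⟩
  · rw [span_singleton_le_iff_mem, mem_span_pair]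
    exact ⟨143 + 169 * thetaInt hα + 57 * thetaInt hα ^ 2, -5 - 6 * thetaInt hα - 6 * thetaInt hα ^ 2, by linear_combination (-18 - 6 * thetaInt hα) * hrel⟩

/-- **Every prime of `𝓞_F` above `2` is principal** (Dedekind–Kummer with `polyMod_2` and the generators above).
[cite: Marcus2018, Ch. 3, Thm. 27] [cite: LMFDB, number field 3.1.1763.1 (class number 1)] -/
theorem isPrincipal_of_mem_primesOver_2 (h3 : finrank ℚ F = 3) (hα : aeval α (poly (-1) (-13) (-16)) = 0) {P : Ideal (𝓞 F)}
    (hP : P ∈ primesOver (span {((2 : ℕ) : ℤ)}) (𝓞 F)) : Submodule.IsPrincipal P := by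
  haveI : Fact (Nat.Prime 2) := ⟨by norm_num⟩
  obtain ⟨Qb, hirr, hmon, hdvd, -, hspan⟩ :=
    exists_factor_of_mem_primesOver irreducible_polyQ hα h3 isUnit_of_disc_eq_sq_mul (by norm_num : Nat.Prime 2) hP
  rw [polyMod_2] at hdvd
  rcases hirr.prime.dvd_or_dvd hdvd with h | h
  · have hQb : Qb = X := eq_of_monic_of_associated hmon monic_X (hirr.associated_of_dvd irreducible_X h)
    have hPeq := hspan X (by rw [hQb, Polynomial.map_X])
    rw [aeval_X, Nat.cast_ofNat, span_2_lin0_eq hα] at hPeq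
    exact ⟨⟨-2 - thetaInt hα, by rw [hPeq, Ideal.submodule_span_eq]⟩⟩
  · have hQb : Qb = X ^ 2 + X + 1 :=
      eq_of_monic_of_associated hmon (by monicity!) (hirr.associated_of_dvd CubicDisc307.irreducible_quad_two h)
    have hPeq := hspan (X ^ 2 + X + 1) (by rw [hQb]; simp)
    rw [show aeval (thetaInt hα) (X ^ 2 + X + 1 : ℤ[X]) = thetaInt hα ^ 2 + thetaInt hα + 1 by
        simp only [map_add, map_pow, aeval_X, map_one], Nat.cast_ofNat, span_2_quad_eq hα] at hPeq
    exact ⟨⟨-7 - 3 * thetaInt hα + thetaInt hα ^ 2, by rw [hPeq, Ideal.submodule_span_eq]⟩⟩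

/-- **Every prime of `𝓞_F` above `3` is principal**: `3` is inert, the prime is `(3)`. [cite: Marcus2018, Ch. 3, Thm. 27] -/
theorem isPrincipal_of_mem_primesOver_3 (h3 : finrank ℚ F = 3) (hα : aeval α (poly (-1) (-13) (-16)) = 0) {P : Ideal (𝓞 F)}
    (hP : P ∈ primesOver (span {((3 : ℕ) : ℤ)}) (𝓞 F)) : Submodule.IsPrincipal P := by
  have hPeq := eq_span_of_no_root irreducible_polyQ hα h3 isUnit_of_disc_eq_sq_mul (by norm_num : Nat.Prime 3) hP no_root_3
  exact ⟨⟨((3 : ℕ) : 𝓞 F), by rw [hPeq, Ideal.submodule_span_eq]⟩⟩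

/-- `(5, θ + 1) = (-1 - θ)` (an element of norm `±5`). [cite: Marcus2018, Ch. 3, Thm. 27] -/
theorem span_5_lin1_eq (hα : aeval α (poly (-1) (-13) (-16)) = 0) :
    span {(5 : 𝓞 F), thetaInt hα + 1} = span {-1 - thetaInt hα} := by
  have hrel := theta_rel hα
  apply le_antisymm
  · rw [span_le]
    rintro x hx
    rcases hx with rfl | hx
    · exact mem_span_singleton'.mpr ⟨11 + 2 * thetaInt hα - thetaInt hα ^ 2, by linear_combination (1) * hrel⟩
    · rw [Set.mem_singleton_iff.mp hx]
      exact mem_span_singleton'.mpr ⟨-1, by linear_combination ((0 : 𝓞 F)) * hrel⟩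
  · rw [span_singleton_le_iff_mem, mem_span_pair]
    exact ⟨17 + 15 * thetaInt hα + 3 * thetaInt hα ^ 2, -6 - 5 * thetaInt hα - 5 * thetaInt hα ^ 2, by linear_combination (-5) * hrel⟩

/-- **Every prime of `𝓞_F` above `5` with `5^f ≤ 11` is principal** (Dedekind–Kummer with `polyMod_5` and the generators above).
[cite: Marcus2018, Ch. 3, Thm. 27] [cite: LMFDB, number field 3.1.1763.1 (class number 1)] -/
theorem isPrincipal_of_mem_primesOver_5 (h3 : finrank ℚ F = 3) (hα : aeval α (poly (-1) (-13) (-16)) = 0) {P : Ideal (𝓞 F)}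
    (hP : P ∈ primesOver (span {((5 : ℕ) : ℤ)}) (𝓞 F))
    (hle : 5 ^ P.inertiaDeg ℤ ≤ 11) : Submodule.IsPrincipal P := by
  haveI : Fact (Nat.Prime 5) := ⟨by norm_num⟩
  obtain ⟨Qb, hirr, hmon, hdvd, hdeg, hspan⟩ :=
    exists_factor_of_mem_primesOver irreducible_polyQ hα h3 isUnit_of_disc_eq_sq_mul (by norm_num : Nat.Prime 5) hP
  rw [polyMod_5] at hdvd
  rcases hirr.prime.dvd_or_dvd hdvd with h | h
  · have hirr1 : Irreducible (X + 1 : (ZMod 5)[X]) := by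
      rw [show (X + 1 : (ZMod 5)[X]) = X - C (-1) by rw [map_neg, map_one, sub_neg_eq_add]]
      exact irreducible_X_sub_C _
    have hQb : Qb = X + 1 := eq_of_monic_of_associated hmon (by monicity!) (hirr.associated_of_dvd hirr1 h)
    have hPeq := hspan (X + 1) (by rw [hQb]; simp)
    rw [show aeval (thetaInt hα) (X + 1 : ℤ[X]) = thetaInt hα + 1 by
        simp only [map_add, aeval_X, map_one], Nat.cast_ofNat, span_5_lin1_eq hα] at hPeq
    exact ⟨⟨-1 - thetaInt hα, by rw [hPeq, Ideal.submodule_span_eq]⟩⟩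
  · have hQb : Qb = X ^ 2 + 3 * X + 4 :=
      eq_of_monic_of_associated hmon (by monicity!) (hirr.associated_of_dvd irreducible_quad_5 h)
    exfalso
    have hd2 : (X ^ 2 + 3 * X + 4 : (ZMod 5)[X]).natDegree = 2 := by compute_degree!
    rw [hdeg, hQb, hd2] at hle
    norm_num at hle

/-- `f` has no root modulo `7`: `7` is inert. [cite: Marcus2018, Ch. 3, Thm. 27] -/
theorem no_root_7' : ∀ r : ZMod 7, r ^ 3 + ((-1 : ℤ) : ZMod 7) * r ^ 2 + ((-13 : ℤ) : ZMod 7) * r + ((-16 : ℤ) : ZMod 7) ≠ 0 := by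
  decide

/-- **Every prime of `𝓞_F` above `7` is principal**: `7` is inert, the prime is `(7)`. [cite: Marcus2018, Ch. 3, Thm. 27] -/
theorem isPrincipal_of_mem_primesOver_7 (h3 : finrank ℚ F = 3) (hα : aeval α (poly (-1) (-13) (-16)) = 0) {P : Ideal (𝓞 F)}
    (hP : P ∈ primesOver (span {((7 : ℕ) : ℤ)}) (𝓞 F)) : Submodule.IsPrincipal P := by
  have hPeq := eq_span_of_no_root irreducible_polyQ hα h3 isUnit_of_disc_eq_sq_mul (by norm_num : Nat.Prime 7) hP no_root_7'
  exact ⟨⟨((7 : ℕ) : 𝓞 F), by rw [hPeq, Ideal.submodule_span_eq]⟩⟩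

/-- `(11, θ + 4) = (-7 - 7 * θ - 2 * θ ^ 2)` (an element of norm `±11`). [cite: Marcus2018, Ch. 3, Thm. 27] -/
theorem span_11_lin4_eq (hα : aeval α (poly (-1) (-13) (-16)) = 0) :
    span {(11 : 𝓞 F), thetaInt hα + 4} = span {-7 - 7 * thetaInt hα - 2 * thetaInt hα ^ 2} := by
  have hrel := theta_rel hα
  apply le_antisymm
  · rw [span_le]
    rintro x hx
    rcases hx with rfl | hx
    · exact mem_span_singleton'.mpr ⟨-45 - 4 * thetaInt hα + 3 * thetaInt hα ^ 2, by linear_combination (-19 - 6 * thetaInt hα) * hrel⟩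
    · rw [Set.mem_singleton_iff.mp hx]
      exact mem_span_singleton'.mpr ⟨-12 - 2 * thetaInt hα + thetaInt hα ^ 2, by linear_combination (-5 - 2 * thetaInt hα) * hrel⟩
  · rw [span_singleton_le_iff_mem, mem_span_pair]
    exact ⟨3, -6 + 3 * thetaInt hα - thetaInt hα ^ 2, by linear_combination (-1) * hrel⟩

/-- **Every prime of `𝓞_F` above `11` with `11^f ≤ 11` is principal** (Dedekind–Kummer with `polyMod_11` and the generators above).
[cite: Marcus2018, Ch. 3, Thm. 27] [cite: LMFDB, number field 3.1.1763.1 (class number 1)] -/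
theorem isPrincipal_of_mem_primesOver_11 (h3 : finrank ℚ F = 3) (hα : aeval α (poly (-1) (-13) (-16)) = 0) {P : Ideal (𝓞 F)}
    (hP : P ∈ primesOver (span {((11 : ℕ) : ℤ)}) (𝓞 F))
    (hle : 11 ^ P.inertiaDeg ℤ ≤ 11) : Submodule.IsPrincipal P := by
  haveI : Fact (Nat.Prime 11) := ⟨by norm_num⟩
  obtain ⟨Qb, hirr, hmon, hdvd, hdeg, hspan⟩ :=
    exists_factor_of_mem_primesOver irreducible_polyQ hα h3 isUnit_of_disc_eq_sq_mul (by norm_num : Nat.Prime 11) hP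
  rw [polyMod_11] at hdvd
  rcases hirr.prime.dvd_or_dvd hdvd with h | h
  · have hirr1 : Irreducible (X + 4 : (ZMod 11)[X]) := by
      rw [show (X + 4 : (ZMod 11)[X]) = X - C (-4) by rw [map_neg, map_ofNat]; ring]
      exact irreducible_X_sub_C _
    have hQb : Qb = X + 4 := eq_of_monic_of_associated hmon (by monicity!) (hirr.associated_of_dvd hirr1 h)
    have hPeq := hspan (X + C 4) (by rw [hQb]; simp [map_ofNat])
    rw [show aeval (thetaInt hα) (X + C 4 : ℤ[X]) = thetaInt hα + 4 by
        simp only [map_add, aeval_X, aeval_C, algebraMap_int_eq, Int.coe_castRingHom, Int.cast_ofNat], Nat.cast_ofNat, span_11_lin4_eq hα] at hPeq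
    exact ⟨⟨-7 - 7 * thetaInt hα - 2 * thetaInt hα ^ 2, by rw [hPeq, Ideal.submodule_span_eq]⟩⟩
  · have hQb : Qb = X ^ 2 + 6 * X + 7 :=
      eq_of_monic_of_associated hmon (by monicity!) (hirr.associated_of_dvd irreducible_quad_11 h)
    exfalso
    have hd2 : (X ^ 2 + 6 * X + 7 : (ZMod 11)[X]).natDegree = 2 := by compute_degree!
    rw [hdeg, hQb, hd2] at hle
    norm_num at hle

/-! ## §4 Class number one -/

/-- **`𝓞_F` is a principal ideal domain.**  Minkowski: every ideal class contains an ideal of norm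
`≤ (4/π)(6/27)√1763 < 12`, and the primes `P` above `p ≤ 11` with `p^f ≤ 11` are principal (§3).
[cite: LMFDB, number field 3.1.1763.1 (class number 1)] [cite: Marcus2018, Ch. 5, Thm. 37 and Cor. 2] -/
theorem isPrincipalIdealRing (h3 : finrank ℚ F = 3) (hα : aeval α (poly (-1) (-13) (-16)) = 0) : IsPrincipalIdealRing (𝓞 F) := by
  apply RingOfIntegers.isPrincipalIdealRing_of_isPrincipal_of_pow_le_of_mem_primesOver_of_mem_Icc
  rw [nrComplexPlaces_eq_one h3 hα, h3, discr_eq h3 hα]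
  intro p hp hpr P hP hle
  obtain ⟨hp1, hpM⟩ := Finset.mem_Icc.mp hp
  have hreal : (4 / π) ^ 1 * ((((3 : ℕ).factorial : ℕ) : ℝ) / ((3 : ℕ) : ℝ) ^ (3 : ℕ) * √|((-1763 : ℤ) : ℝ)|) < ((12 : ℕ) : ℝ) := by
    have hπ := Real.pi_gt_d2
    have hπ0 := Real.pi_pos
    have hs : √(1763 : ℝ) < 41.99 := by
      rw [Real.sqrt_lt' (by norm_num)]; norm_num
    have hs0 : 0 ≤ √(1763 : ℝ) := Real.sqrt_nonneg _
    have habs : |((-1763 : ℤ) : ℝ)| = 1763 := by norm_num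
    rw [habs]
    norm_num [Nat.factorial]
    rw [div_mul_eq_mul_div, div_lt_iff₀ hπ0]
    nlinarith
  have hfl := Nat.lt_succ_iff.mp ((Nat.floor_lt' (by norm_num)).mpr hreal)
  have hpB : p ≤ 11 := hpM.trans hfl
  have hleB : p ^ P.inertiaDeg ℤ ≤ 11 := hle.trans hfl
  clear hpM hle hp
  interval_cases p
  · exact absurd hpr (by norm_num)
  · exact isPrincipal_of_mem_primesOver_2 h3 hα hP
  · exact isPrincipal_of_mem_primesOver_3 h3 hα hP
  · exact absurd hpr (by norm_num)
  · exact isPrincipal_of_mem_primesOver_5 h3 hα hP hleB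
  · exact absurd hpr (by norm_num)
  · exact isPrincipal_of_mem_primesOver_7 h3 hα hP
  · exact absurd hpr (by norm_num)
  · exact absurd hpr (by norm_num)
  · exact absurd hpr (by norm_num)
  · exact isPrincipal_of_mem_primesOver_11 h3 hα hP hleB

/-- ★ **`h_F = 1`: the cubic field of discriminant `−1763` has class number one.** [cite: LMFDB, number field 3.1.1763.1 (class number 1)] -/
theorem classNumber_eq_one (h3 : finrank ℚ F = 3) (hα : aeval α (poly (-1) (-13) (-16)) = 0) : classNumber F = 1 :=
  (classNumber_eq_one_iff (K := F)).mpr (isPrincipalIdealRing h3 hα)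

/-- **`h_F` is odd** (the form consumed by the `2`-adic doors of cell `bsd-f1-sign2`). [cite: LMFDB, number field 3.1.1763.1 (class number 1)] -/
theorem not_two_dvd_classNumber (h3 : finrank ℚ F = 3) (hα : aeval α (poly (-1) (-13) (-16)) = 0) : ¬ 2 ∣ classNumber F := by
  rw [classNumber_eq_one h3 hα]; decide

end NumberField

end Literature.NumberTheory.CubicFields.CubicDisc1763

end
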